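import Summits.HubbardSuperconductivity.HubbardSuperconductivity.Theorems.BalabanIRBirComplexStableXYStiffnessHolomorphy
import Summits.HubbardSuperconductivity.HubbardSuperconductivity.Theorems.BalabanIRBirComplexStableXYStiffnessAdmissible
import Summits.HubbardSuperconductivity.HubbardSuperconductivity.Theorems.BalabanIRBirComplexStableXYHolomorphicTwoLevelZero

/-!
# Line `theta-rotor-equimodular-zeros` — NEGATIVE skeleton v3 (holomorphic-stiffness endgame) for crux
`BalabanIR.BirComplexStableXY` (stmt-HubbardSuperconductivity-2080), line lead prover-line-stmt-HubbardSuperconductivity-2080-0.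

Same Beraha–Kahane–Weiss mechanism as v1/v2 (whose stubs S0 continuity p87260, S3 planar Brouwer zero lemma p88521, S2a-i torus
contour shift p89530, S2a-ii gauge/twist identity p90294 are LANDED and stay valid supports), re-coordinatised after crux idea
`holomorphic-stiffness-hurwitz` (ideator 6): the complex temporal STIFFNESS `a` is a holomorphic coordinate INSIDE the admissible
class (coercivity (C) only sees `Re a`), `Z` is entire in `a`, and the zero follows from the two-level structure by Hurwitz's theorem
in ONE complex variable — the non-degeneracy input drops from "invertible real Jacobian of the eigenvalue ratio" (an O(1/κ²)
anharmonic quantity) to "the holomorphic ratio `u` is non-constant", and the tie point can be taken at REAL stiffness `a₀`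
(where the transfer operator is positive self-adjoint).

Stubs: S0h `stub_partZ_stiff_differentiable` (LANDED p90955) · S1h `stub_stiffTab_admissible` (LANDED p91466) ·
S3h `stub_holomorphicTwoLevelZeroLemma` (LANDED p92099) · S2h `stub_stiffTwoLevelStructure` (hardest, lead, OPEN — research-sized).
Composition `not_BirComplexStableXY` sorry-free below the stubs; landed form: Theorems/BirComplexStableXY/Negative/
BirComplexStableXYFalseOfStiffTwoLevelStructure.lean (`BirComplexStableXY_false_of_StiffTwoLevelStructure`, negative-modulo H = S2h).
The stiffness family is written inline: `spatialTab + a • temporalCosTab + (Complex.I * ε₂) • temporalSinTab`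
(`= witness ε₁ ε₂` at `a = 1 + iε₁`).
-/

namespace Summit.HubbardSuperconductivity.BirComplexStableXYNegative

open scoped BigOperators
open MeasureTheory Metric Literature.Probability.LatticeModels

noncomputable section

-- S0h `stub_partZ_stiff_differentiable` LANDED: Theorems/BalabanIRBirComplexStableXYStiffnessHolomorphy.lean (p90955).

-- S1h `stub_stiffTab_admissible` LANDED: Theorems/BalabanIRBirComplexStableXYStiffnessAdmissible.lean (p91466).

-- S3h `stub_holomorphicTwoLevelZeroLemma` LANDED: Theorems/BalabanIRBirComplexStableXYHolomorphicTwoLevelZero.lean (p92099).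

/-- S2h (stub, hardest — held by the lead): the Beraha–Kahane–Weiss TWO-LEVEL STRUCTURE in the holomorphic stiffness
coordinate.  For every `K₀, L₀` there are `K ≥ K₀`, `L ≥ L₀`, a Berry parameter `|ε₂| ≤ 1/5`, a stiffness `a₀` with a disc
inside the admissible disc `‖a − 1‖ ≤ 1/4` (expected: `a₀` REAL, where the slice transfer operator is positive self-adjoint and
the modulus tie `‖u a₀‖ = 1` of the charge sectors `Q = 0`, `Q = −1` is one real equation solved by the intermediate value theorem
in `ε₂`), a holomorphic NON-CONSTANT sector ratio `u` (`= μ₋₁ e^{−iψ}/μ₀`, Kato-holomorphic in `a` as long as both tops are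
simple) and a holomorphic non-vanishing normaliser `lam` (the dominant eigenvalue branch) with the geometric two-level bound
`‖Z_M(a)/lam(a)^M − 1 − u(a)^M‖ ≤ C q^M`, `q < 1` (spectral gap below the two tops), uniformly on the disc. -/
theorem stub_stiffTwoLevelStructure :
    ∀ (K₀ : ℝ) (L₀ : ℕ), ∃ K : ℝ, K₀ ≤ K ∧ ∃ (L : ℕ) (_ : NeZero L), L₀ ≤ L ∧
      ∃ ε₂ : ℝ, |ε₂| ≤ 1/5 ∧
      ∃ (a₀ : ℂ) (ρ C q : ℝ), 0 < ρ ∧ 0 ≤ q ∧ q < 1 ∧ closedBall a₀ ρ ⊆ closedBall (1 : ℂ) (1/4) ∧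
        ∃ u lam : ℂ → ℂ, DifferentiableOn ℂ u (ball a₀ ρ) ∧ ‖u a₀‖ = 1 ∧ (∃ a ∈ ball a₀ ρ, u a ≠ u a₀) ∧
          DifferentiableOn ℂ lam (ball a₀ ρ) ∧ (∀ a ∈ ball a₀ ρ, lam a ≠ 0) ∧
          ∃ M₁ : ℕ, ∀ M : ℕ, M₁ ≤ M → ∀ (_ : NeZero M), ∀ a ∈ ball a₀ ρ,
            ‖partZ K (spatialTab + a • temporalCosTab + (Complex.I * ε₂) • temporalSinTab) L M / (lam a) ^ M
                - 1 - (u a) ^ M‖ ≤ C * q ^ M := by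
  sorry

/-- The normalised family `f M a = Z_M(a)/lam(a)^M` in the stiffness coordinate (value `1` at the junk index `M = 0`). -/
def normalisedStiffZ (K ε₂ : ℝ) (L : ℕ) [NeZero L] (lam : ℂ → ℂ) (M : ℕ) (a : ℂ) : ℂ :=
  if h : M = 0 then 1 else
    (haveI : NeZero M := ⟨h⟩;
      partZ K (spatialTab + a • temporalCosTab + (Complex.I * ε₂) • temporalSinTab) L M / (lam a) ^ M)

theorem normalisedStiffZ_of_neZero (K ε₂ : ℝ) (L : ℕ) [NeZero L] (lam : ℂ → ℂ) (M : ℕ) [hM : NeZero M] (a : ℂ) :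
    normalisedStiffZ K ε₂ L lam M a =
      partZ K (spatialTab + a • temporalCosTab + (Complex.I * ε₂) • temporalSinTab) L M / (lam a) ^ M := by
  unfold normalisedStiffZ
  rw [dif_neg hM.ne]

/-- ZEROS (sorry-free given the stubs): S0h + S2h + S3h ⟹ for every `K₀, L₀` there are `K ≥ K₀`, `L₀ ≤ L ≤ M` and an
admissible-disc stiffness `a` (`‖a − 1‖ ≤ 1/4`) and `|ε₂| ≤ 1/5` with `Z = 0`. -/
theorem stiffZeroExists_of_stubs :
    ∀ (K₀ : ℝ) (L₀ : ℕ), ∃ K : ℝ, K₀ ≤ K ∧ ∃ (a : ℂ) (ε₂ : ℝ), ‖a - 1‖ ≤ 1/4 ∧ |ε₂| ≤ 1/5 ∧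
      ∃ (L M : ℕ) (_ : NeZero L) (_ : NeZero M), L₀ ≤ L ∧ L ≤ M ∧
        partZ K (spatialTab + a • temporalCosTab + (Complex.I * ε₂) • temporalSinTab) L M = 0 := by
  intro K₀ L₀
  obtain ⟨K, hK, L, hL, hL₀, ε₂, hε₂, a₀, ρ, C, q, hρ, hq0, hq1, hdisc, u, lam, hu, hnorm, hnc, hlam, hlam0, M₁, happrox⟩ :=
    stub_stiffTwoLevelStructure K₀ L₀
  -- holomorphy of the normalised family on the disc
  have hdiff : ∀ M : ℕ, DifferentiableOn ℂ (normalisedStiffZ K ε₂ L lam M) (ball a₀ ρ) := by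
    intro M
    by_cases hM : M = 0
    · subst hM
      have h0 : normalisedStiffZ K ε₂ L lam 0 = fun _ => 1 := by
        funext a
        simp [normalisedStiffZ]
      rw [h0]
      exact differentiableOn_const 1
    · haveI : NeZero M := ⟨hM⟩
      have h1 : DifferentiableOn ℂ (fun a : ℂ =>
          partZ K (spatialTab + a • temporalCosTab + (Complex.I * ε₂) • temporalSinTab) L M) (ball a₀ ρ) :=
        (stub_partZ_stiff_differentiable K ε₂ L M).differentiableOn
      have h2 : DifferentiableOn ℂ (fun a : ℂ => (lam a) ^ M) (ball a₀ ρ) := hlam.pow M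
      have h3 := h1.div h2 (fun a ha => pow_ne_zero M (hlam0 a ha))
      refine h3.congr ?_
      intro a _
      exact normalisedStiffZ_of_neZero K ε₂ L lam M a
  -- the geometric two-level bound for the normalised family
  have happrox' : ∃ M₁' : ℕ, ∀ M : ℕ, M₁' ≤ M → ∀ a ∈ ball a₀ ρ,
      ‖normalisedStiffZ K ε₂ L lam M a - 1 - (u a) ^ M‖ ≤ C * q ^ M := by
    refine ⟨max M₁ 1, fun M hM a ha => ?_⟩
    have hM0 : M ≠ 0 := by
      have : 1 ≤ M := le_trans (le_max_right _ _) hM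
      omega
    haveI : NeZero M := ⟨hM0⟩
    rw [normalisedStiffZ_of_neZero]
    exact happrox M (le_trans (le_max_left _ _) hM) inferInstance a ha
  obtain ⟨M₀, hM₀⟩ :=
    stub_holomorphicTwoLevelZeroLemma u (normalisedStiffZ K ε₂ L lam) a₀ ρ C q hρ hq0 hq1 hu hnorm hnc hdiff happrox'
  -- pick `M ≥ max M₀ L`, `M ≥ 1`
  set M : ℕ := max (max M₀ L) 1 with hMdef
  have hM1 : 1 ≤ M := le_max_right _ _
  have hM0' : M ≠ 0 := by omega
  haveI hMne : NeZero M := ⟨hM0'⟩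
  obtain ⟨a, ha, hzero⟩ := hM₀ M (le_trans (le_max_left _ _) (le_max_left _ _))
  rw [normalisedStiffZ_of_neZero] at hzero
  have hZ : partZ K (spatialTab + a • temporalCosTab + (Complex.I * ε₂) • temporalSinTab) L M = 0 := by
    rcases div_eq_zero_iff.mp hzero with h | h
    · exact h
    · exact absurd (pow_eq_zero_iff hM0' |>.mp h) (hlam0 a ha)
  have ha' : ‖a - 1‖ ≤ 1/4 := by
    have : a ∈ closedBall (1 : ℂ) (1/4) := hdisc (ball_subset_closedBall ha)
    simpa [mem_closedBall, dist_eq_norm] using this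
  exact ⟨K, hK, a, ε₂, ha', hε₂, L, M, hL, hMne, hL₀, le_trans (le_max_right _ _) (le_max_left _ _), hZ⟩

/-- THE LINE'S CONCLUSION (sorry only inside the stubs): the typed crux is false — instantiate it at `r = 2`, `B = 128`,
`c₀ = 1/24`, feed the admissible stiffness table at a zero of `Z`. -/
theorem not_BirComplexStableXY :
    ¬ Summit.HubbardSuperconductivity.HubbardSuperconductivity.Theses.BalabanIR.BirComplexStableXY := by
  intro h
  obtain ⟨K₀, L₀, hK⟩ := h 2 128 (1/24) le_rfl (by norm_num)
  obtain ⟨K, hKK, a, ε₂, ha, hε₂, L, M, _, _, hL, hLM, hZ⟩ := stiffZeroExists_of_stubs K₀ L₀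
  obtain ⟨hU1, hN, hA, hC⟩ := stub_stiffTab_admissible a ε₂ ha hε₂
  have key := hK K hKK (spatialTab + a • temporalCosTab + (Complex.I * ε₂) • temporalSinTab) hU1 hN hA hC L M hL hLM
  dsimp only at key
  dsimp only [partZ, action, genF, sh, cube] at hZ
  exact key.1 hZ

end

end Summit.HubbardSuperconductivity.BirComplexStableXYNegative
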